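import Summits.BirchSwinnertonDyer.BirchSwinnertonDyer.Theorems.BiquadraticEisensteinDescentHeegnerTwistCouplingInSupplyIndefinitePinWitness
import HarnessLib

set_option linter.dupNamespace false -- `Summit.BirchSwinnertonDyer.BirchSwinnertonDyer.Theorems.…` (summit = sub)
set_option autoImplicit false

/-!
# Crux `HeegnerTwistCouplingInSupply` (stmt-BirchSwinnertonDyer-21381) — the conclusion of the crux on the WHOLE
# congruent corner `W = E_{2p}` (`p ≡ 3 (mod 4)` prime, `p ≥ 7`) and on `W = E_p` for `p ≡ 7 (mod 8)`,
# `p ≡ ±2 (mod 5)`, modulo the five named facts of p645024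

Route `BiquadraticEisensteinDescent` (cell `pub/bsd-wall`, row-12 line lead `bsd-line-ibd-p1` g11). Assembly of this
lead's `…IndefinitePin` (p648070: auxiliary primes `q ≡ 3 (mod 8)` of type `(3,+)` for every `p ≡ 3 (mod 4)`, `q ≤ 10p`,
and of type `(3,−)` for every `p ≡ 3 (mod 8)`, `q ≤ 4p`, from INDEFINITE ternary forms), `…PartnerTables` (p648499:
kernel partners below `800` / `200` with `h(−5q) < p`) and `…IndefinitePinWitness` (the Heegner field `K′ = ℚ(√−5q)`
with `h(K′) < p`, size lever `π⁻¹√x log x < p` for `x < c·p`) with the g10 layer (p643875 Monsky cells, p644288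
journal door, p645024/p645829 corners): the partner prime is now `5` on the OTHER side of the cell — `5` has type
`(5,−)` iff `p ≡ ±2 (mod 5)` and type `(5,+)` iff `p ≡ ±1 (mod 5)`. Results (THEOREMS ONLY, every arithmetic input
a hypothesis BY NAME — Modularity `exists_isNewformOf`, Monsky's matrix theorem (even / odd), Burungale–Tian,
Deuring–Hecke `hasEntireLFunction_of_j_mem_maximalCMJInvariants`, Burungale–Flach — exactly as in p645024):

* `cruxOnE2pCornerCellA_of_facts` — every prime `p ≡ 3 (mod 4)`, `p ≡ ±2 (mod 5)`, `p ≥ 7`: cell A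
  `{q = (3,+), 5 = (5,−)}`, `L(E_{2p}^{(−5q)}, 1) ≠ 0`, `h(ℚ(√−5q)) < p`;
* `cruxOnE2pCornerCellB_of_mod_eight_eq_three_of_facts` — every prime `p ≡ 3 (mod 8)`, `p ≡ ±1 (mod 5)`: cell B
  `{q = (3,−), 5 = (5,+)}` (the `p ≡ 3 (mod 8)` half the definite dual pin of p643125 could not reach);
* `cruxOnE2pCorner_of_facts` — **EVERY prime `p ≡ 3 (mod 4)`, `p ≥ 7`**: a Heegner field `K′` of `N(E_{2p}) = 64p²`
  with `4 < |d_{K′}|`, `L(E_{2p}^{(d_{K′})}, 1) ≠ 0`, `h(K′) < p` and `p ∤ h(K′)` — the CONCLUSION of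
  `HeegnerTwistCouplingInSupply` for `W = E_{2p}` with no coupling / density / divisibility input (union of the two
  cells above and p645829's `p ≡ 7 (mod 8) ∧ ±1 (mod 5)` corner);
* `cruxOnEpCornerCellA_of_facts` — every prime `p ≡ 7 (mod 8)`, `p ≡ ±2 (mod 5)`: the row-1 cell with `(q, 5)`,
  `L(E_p^{(−5q)}, 1) ≠ 0`, `h < p`; `cruxOnEpCorner_of_facts` — union with p645024's `p ≡ 23 (mod 24)`:
  every prime `p ≡ 7 (mod 8)` with `p ≡ 2 (mod 3)` or `p ≡ ±2 (mod 5)`.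

What is NOT here: `W = E_p` for `p ≡ 7 (mod 8)`, `p ≡ 1 (mod 3)`, `p ≡ ±1 (mod 5)` (both cell primes would have to
be pinned, `|d| ≍ p²`, no size lever); other `j = 1728` curves; `j ≠ 1728`; and of course the crux itself (all CM `W`
of analytic rank one) — its residual is the coupling on the tail (C⁺). BSD is not proved by any of this. Supports
stmt-BirchSwinnertonDyer-21381 (typed sub-corner rungs, not the crux).
-/

namespace Summit.BirchSwinnertonDyer.BirchSwinnertonDyer.Theorems.BiquadraticEisensteinDescentHeegnerTwistCouplingInSupplyIndefinitePinCorner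

open Literature.NumberTheory.EllipticCurves Literature.NumberTheory.EllipticCurves.HeathBrown1994
  Literature.NumberTheory.EllipticCurves.HeathBrown1994.Families
  Literature.NumberTheory.QuadraticFields Literature.NumberTheory.QuadraticFields.Quadratic
  Summit.BirchSwinnertonDyer.BirchSwinnertonDyer.Theorems.BiquadraticEisensteinDescentHeegnerTwistCouplingInSupplyThreeSquaresPinDual
  Summit.BirchSwinnertonDyer.BirchSwinnertonDyer.Theorems.BiquadraticEisensteinDescentHeegnerTwistCouplingInSupplyMonskyCells
  Summit.BirchSwinnertonDyer.BirchSwinnertonDyer.Theorems.BiquadraticEisensteinDescentHeegnerTwistCouplingInSupplyThreeSquaresPinRankZero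
  Summit.BirchSwinnertonDyer.BirchSwinnertonDyer.Theorems.BiquadraticEisensteinDescentHeegnerTwistCouplingInSupplySizeIndivisibleSharp
  Summit.BirchSwinnertonDyer.BirchSwinnertonDyer.Theorems.BiquadraticEisensteinDescentHeegnerTwistCouplingInSupplyThreeSquaresPinCorner
  Summit.BirchSwinnertonDyer.BirchSwinnertonDyer.Theorems.BiquadraticEisensteinDescentHeegnerTwistCouplingInSupplyThreeSquaresPinCornerDual
  Summit.BirchSwinnertonDyer.BirchSwinnertonDyer.Theorems.BiquadraticEisensteinDescentHeegnerTwistCouplingInSupplyIndefinitePin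
  Summit.BirchSwinnertonDyer.BirchSwinnertonDyer.Theorems.BiquadraticEisensteinDescentHeegnerTwistCouplingInSupplyPartnerTables
  Summit.BirchSwinnertonDyer.BirchSwinnertonDyer.Theorems.BiquadraticEisensteinDescentHeegnerTwistCouplingInSupplyIndefinitePinWitness

/-! ## §1 Analytic rank zero of the Heegner twist (the `L`-half), modulo the four named facts -/

/-- **Cell A with the partner `5`, corner `E_{2p}`**: `p ≡ 3 (mod 4)`, `p ≡ ±2 (mod 5)`, `q` of type `(3,+)` ⇒
`E_{2p·5q}` has analytic rank `0` and `L(E_{2p·5q}, 1) ≠ 0`. [cite: HeathBrown1994SelmerCongruentII, Appendix (Monsky), typescript p. 41 L20–L36]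
[cite: BurungaleTian2026, Thm. 1.1] [cite: BurungaleFlach2024, Thm. 1.1 and Cor. 2] -/
theorem analyticRank_eq_zero_cellA_five (hM : monsky_card_selmerGroup_two_even)
    (hBT : burungaleTian_analyticRank_eq_zero_of_selmerCorank_eq_zero_of_hasCM)
    (hH : hasEntireLFunction_of_j_mem_maximalCMJInvariants) (hBF : bsdTriple_of_hasCM_of_L_one_ne_zero)
    {p q : ℕ} (hp : p.Prime) (hp4 : p % 4 = 3) (hp5 : p % 5 = 2 ∨ p % 5 = 3) (hq : q.Prime) (hq8 : q % 8 = 3)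
    (hJ : jacobiSym (q : ℤ) p = 1) :
    Squarefree (2 * p * (q * 5)) ∧ (congruentNumberCurve (2 * p * (q * 5))).BSDTriple ∧
      (congruentNumberCurve (2 * p * (q * 5))).analyticRank = 0 ∧
      (congruentNumberCurve (2 * p * (q * 5))).entireLFunction 1 ≠ 0 := by
  have h5p : jacobiSym ((5 : ℕ) : ℤ) p = -1 := by exact_mod_cast jacobiSym_five_eq_neg_one (p := p) (by omega) hp5
  have hdet := det_monskyMatrixEven_cellA (p := p) hq Nat.prime_five hp4 hq8 (by norm_num) hJ h5p
  have hqp : q ≠ p := ne_of_jacobiSym_ne_zero hp (by rw [hJ]; norm_num)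
  have hp5' : p ≠ 5 := by rintro rfl; omega
  have hq5 : q ≠ 5 := by rintro rfl; omega
  exact analyticRank_eq_zero_of_det_even hM hBT hH hBF hp hq Nat.prime_five (by omega) (by omega) (by norm_num)
    (Ne.symm hqp) hp5' hq5 hdet

/-- **Cell B with the partner `5`, corner `E_{2p}`**: `p ≡ 3 (mod 4)`, `p ≡ ±1 (mod 5)`, `q` of type `(3,−)` ⇒
`E_{2p·5q}` has analytic rank `0`. [cite: HeathBrown1994SelmerCongruentII, Appendix (Monsky), typescript p. 41 L20–L36]
[cite: BurungaleTian2026, Thm. 1.1] [cite: BurungaleFlach2024, Thm. 1.1 and Cor. 2] -/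
theorem analyticRank_eq_zero_cellB_five (hM : monsky_card_selmerGroup_two_even)
    (hBT : burungaleTian_analyticRank_eq_zero_of_selmerCorank_eq_zero_of_hasCM)
    (hH : hasEntireLFunction_of_j_mem_maximalCMJInvariants) (hBF : bsdTriple_of_hasCM_of_L_one_ne_zero)
    {p q : ℕ} (hp : p.Prime) (hp4 : p % 4 = 3) (hp5 : p % 5 = 1 ∨ p % 5 = 4) (hq : q.Prime) (hq8 : q % 8 = 3)
    (hJ : jacobiSym (q : ℤ) p = -1) :
    Squarefree (2 * p * (q * 5)) ∧ (congruentNumberCurve (2 * p * (q * 5))).BSDTriple ∧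
      (congruentNumberCurve (2 * p * (q * 5))).analyticRank = 0 ∧
      (congruentNumberCurve (2 * p * (q * 5))).entireLFunction 1 ≠ 0 := by
  have hdet := det_monskyMatrixEven_dualPin_five hp4 hp5 hq hq8 hJ
  have hqp : q ≠ p := ne_of_jacobiSym_ne_zero hp (by rw [hJ]; norm_num)
  have hp5' : p ≠ 5 := by rintro rfl; omega
  have hq5 : q ≠ 5 := by rintro rfl; omega
  exact analyticRank_eq_zero_of_det_even hM hBT hH hBF hp hq Nat.prime_five (by omega) (by omega) (by norm_num)
    (Ne.symm hqp) hp5' hq5 hdet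

/-- **Row-1 cell with the partner `5`, corner `E_p`**: `p ≡ 7 (mod 8)`, `p ≡ ±2 (mod 5)`, `q ≡ 3 (mod 8)` prime,
`q ≠ p` ⇒ `E_{p·5q}` has analytic rank `0` (odd case of Monsky's theorem; the determinant does not see `(q/p)`).
[cite: HeathBrown1994SelmerCongruentII, Appendix (Monsky), typescript p. 39 L27–L33] [cite: BurungaleTian2026, Thm. 1.1]
[cite: BurungaleFlach2024, Thm. 1.1 and Cor. 2] -/
theorem analyticRank_eq_zero_odd_five (hM : monsky_card_selmerGroup_two_odd)
    (hBT : burungaleTian_analyticRank_eq_zero_of_selmerCorank_eq_zero_of_hasCM)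
    (hH : hasEntireLFunction_of_j_mem_maximalCMJInvariants) (hBF : bsdTriple_of_hasCM_of_L_one_ne_zero)
    {p q : ℕ} (hp : p.Prime) (hp8 : p % 8 = 7) (hp5 : p % 5 = 2 ∨ p % 5 = 3) (hq : q.Prime) (hq8 : q % 8 = 3)
    (hqp : q ≠ p) :
    Squarefree (p * (q * 5)) ∧ (congruentNumberCurve (p * (q * 5))).BSDTriple ∧
      (congruentNumberCurve (p * (q * 5))).analyticRank = 0 ∧
      (congruentNumberCurve (p * (q * 5))).entireLFunction 1 ≠ 0 := by
  have h5p : jacobiSym ((5 : ℕ) : ℤ) p = -1 := by exact_mod_cast jacobiSym_five_eq_neg_one (p := p) (by omega) hp5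
  have hdet := det_monskyMatrixOdd_cell_seven_mod_eight (p := p) hp hq Nat.prime_five hp8 hq8 (by norm_num) h5p
  have hp5' : p ≠ 5 := by rintro rfl; omega
  have hq5 : q ≠ 5 := by rintro rfl; omega
  exact analyticRank_eq_zero_of_det_odd hM hBT hH hBF hp hq Nat.prime_five (by omega) (by omega) (by norm_num)
    (Ne.symm hqp) hp5' hq5 hdet

/-! ## §2 The corner theorems -/

/-- **Corner `W = E_{2p}`, cell A: every prime `p ≡ 3 (mod 4)`, `p ≡ ±2 (mod 5)`, `p ≥ 7`** — modulo Modularity +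
Monsky (even) + Burungale–Tian + Deuring–Hecke + Burungale–Flach: an auxiliary prime `q ≡ 3 (mod 8)` with `(q/p) = +1`
and the Heegner field `K′ = ℚ(√−5q)` of `N(E_{2p}) = 64p²` with `L(E_{2p}^{(−5q)}, 1) ≠ 0` and `h(K′) < p`.
[cite: HeathBrown1994SelmerCongruentII, Appendix (Monsky), typescript p. 41 L20–L36] [cite: BurungaleTian2026, Thm. 1.1]
[cite: BurungaleFlach2024, Thm. 1.1 and Cor. 2] [cite: KoblitzECMF1993, Ch. II §5, Theorem (p. 84)] -/
theorem cruxOnE2pCornerCellA_of_facts (hmod : ModularForms.exists_isNewformOf) (hM : monsky_card_selmerGroup_two_even)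
    (hBT : burungaleTian_analyticRank_eq_zero_of_selmerCorank_eq_zero_of_hasCM)
    (hH : hasEntireLFunction_of_j_mem_maximalCMJInvariants) (hBF : bsdTriple_of_hasCM_of_L_one_ne_zero) :
    ∀ (p : ℕ) [Fact p.Prime] [(congruentNumberCurve (2 * p)).IsElliptic]
      [(congruentNumberCurve (2 * p)).IsGloballyMinimal]
      [NeZero ((congruentNumberCurve (2 * p)).conductorNorm ℤ)],
      p % 4 = 3 → (p % 5 = 2 ∨ p % 5 = 3) → 7 ≤ p →
      ∃ (q : ℕ) (K : Type) (_ : Field K) (_ : NumberField K),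
        q.Prime ∧ q % 8 = 3 ∧ jacobiSym (q : ℤ) p = 1 ∧
        IsImaginaryQuadratic K ∧ NumberField.discr K = -((5 * q : ℕ) : ℤ) ∧
        SatisfiesHeegnerHypothesis ((congruentNumberCurve (2 * p)).conductorNorm ℤ) K ∧
        ((congruentNumberCurve (2 * p)).quadraticTwist (NumberField.discr K : ℚ)).entireLFunction 1 ≠ 0 ∧
        NumberField.classNumber K < p := by
  intro p hpF _ _ _ hp4 hp5 h7
  have hp : p.Prime := hpF.out
  obtain ⟨q, hq, hq8, hJ, hh⟩ := exists_threePlus_classNumber_lt hp hp4 hp5 h7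
  obtain ⟨-, -, -, hL⟩ := analyticRank_eq_zero_cellA_five hM hBT hH hBF hp hp4 hp5 hq hq8 hJ
  have hsq2p : Squarefree (2 * p) := by
    rw [Nat.squarefree_mul ((Nat.coprime_primes Nat.prime_two hp).mpr (by omega))]
    exact ⟨Nat.prime_two.squarefree, hp.squarefree⟩
  have hN : (congruentNumberCurve (2 * p)).conductorNorm ℤ = 64 * p ^ 2 :=
    (rootNumber_eq_and_conductorNorm_congruentNumberCurve_two_mul hmod hsq2p).2
  obtain ⟨K, iF, iN, hK, hdK, hH', hcl⟩ := exists_witnessField_five_of (N := (congruentNumberCurve (2 * p)).conductorNorm ℤ)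
    hq hq8 (jacobiSym_neg_five_mul_cellA hp4 hp5 hJ) hh
    (fun r hr hrN => eq_two_or_eq_of_prime_dvd_sixtyFour_mul_sq hp hr (hN ▸ hrN))
  refine ⟨q, K, iF, iN, hq, hq8, hJ, hK, hdK, hH', ?_, hcl⟩
  rw [hdK, quadraticTwist_congruentNumberCurve, Int.natAbs_neg, Int.natAbs_natCast]
  have h55 : 2 * p * (5 * q) = 2 * p * (q * 5) := by ring
  rw [h55]
  exact hL

/-- **Corner `W = E_{2p}`, cell B on the `p ≡ 3 (mod 8)` half: every prime `p ≡ 3 (mod 8)`, `p ≡ ±1 (mod 5)`** —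
modulo the same five named facts: an auxiliary prime `q ≡ 3 (mod 8)` with `(q/p) = −1` and `K′ = ℚ(√−5q)` with
`L(E_{2p}^{(−5q)}, 1) ≠ 0`, `h(K′) < p`. (The `p ≡ 7 (mod 8)` half is p645829's
`cruxOnE2pCornerMod5_of_mod_eight_eq_seven_of_facts`, with `q < p`.)
[cite: HeathBrown1994SelmerCongruentII, Appendix (Monsky), typescript p. 41 L20–L36] [cite: BurungaleTian2026, Thm. 1.1]
[cite: BurungaleFlach2024, Thm. 1.1 and Cor. 2] [cite: KoblitzECMF1993, Ch. II §5, Theorem (p. 84)] -/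
theorem cruxOnE2pCornerCellB_of_mod_eight_eq_three_of_facts (hmod : ModularForms.exists_isNewformOf)
    (hM : monsky_card_selmerGroup_two_even)
    (hBT : burungaleTian_analyticRank_eq_zero_of_selmerCorank_eq_zero_of_hasCM)
    (hH : hasEntireLFunction_of_j_mem_maximalCMJInvariants) (hBF : bsdTriple_of_hasCM_of_L_one_ne_zero) :
    ∀ (p : ℕ) [Fact p.Prime] [(congruentNumberCurve (2 * p)).IsElliptic]
      [(congruentNumberCurve (2 * p)).IsGloballyMinimal]
      [NeZero ((congruentNumberCurve (2 * p)).conductorNorm ℤ)],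
      p % 8 = 3 → (p % 5 = 1 ∨ p % 5 = 4) →
      ∃ (q : ℕ) (K : Type) (_ : Field K) (_ : NumberField K),
        q.Prime ∧ q % 8 = 3 ∧ jacobiSym (q : ℤ) p = -1 ∧
        IsImaginaryQuadratic K ∧ NumberField.discr K = -((5 * q : ℕ) : ℤ) ∧
        SatisfiesHeegnerHypothesis ((congruentNumberCurve (2 * p)).conductorNorm ℤ) K ∧
        ((congruentNumberCurve (2 * p)).quadraticTwist (NumberField.discr K : ℚ)).entireLFunction 1 ≠ 0 ∧
        NumberField.classNumber K < p := by
  intro p hpF _ _ _ hp8 hp5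
  have hp : p.Prime := hpF.out
  have hp4 : p % 4 = 3 := by omega
  obtain ⟨q, hq, hq8, hJ, hh⟩ := exists_threeMinus_classNumber_lt hp hp8 hp5
  obtain ⟨-, -, -, hL⟩ := analyticRank_eq_zero_cellB_five hM hBT hH hBF hp hp4 hp5 hq hq8 hJ
  have hsq2p : Squarefree (2 * p) := by
    rw [Nat.squarefree_mul ((Nat.coprime_primes Nat.prime_two hp).mpr (by omega))]
    exact ⟨Nat.prime_two.squarefree, hp.squarefree⟩
  have hN : (congruentNumberCurve (2 * p)).conductorNorm ℤ = 64 * p ^ 2 :=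
    (rootNumber_eq_and_conductorNorm_congruentNumberCurve_two_mul hmod hsq2p).2
  obtain ⟨K, iF, iN, hK, hdK, hH', hcl⟩ := exists_witnessField_five_of (N := (congruentNumberCurve (2 * p)).conductorNorm ℤ)
    hq hq8 (jacobiSym_neg_five_mul_cellB hp4 hp5 hJ) hh
    (fun r hr hrN => eq_two_or_eq_of_prime_dvd_sixtyFour_mul_sq hp hr (hN ▸ hrN))
  refine ⟨q, K, iF, iN, hq, hq8, hJ, hK, hdK, hH', ?_, hcl⟩
  rw [hdK, quadraticTwist_congruentNumberCurve, Int.natAbs_neg, Int.natAbs_natCast]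
  have h55 : 2 * p * (5 * q) = 2 * p * (q * 5) := by ring
  rw [h55]
  exact hL

/-- **THE CONGRUENT CORNER `W = E_{2p}` IN FULL: every prime `p ≡ 3 (mod 4)`, `p ≥ 7`** — modulo Modularity + Monsky
(even) + Burungale–Tian + Deuring–Hecke + Burungale–Flach there is a Heegner field `K′` of `N(E_{2p})` with
`4 < |d_{K′}|`, `L(E_{2p}^{(d_{K′})}, 1) ≠ 0`, `h(K′) < p`, hence `p ∤ h(K′)`: the CONCLUSION of crux
`HeegnerTwistCouplingInSupply` for `W = E_{2p}` (CM by `ℤ[i]`, `p` inert and additive), by cells A (`p ≡ ±2 (mod 5)`),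
B (`p ≡ ±1 (mod 5)`, `p ≡ 3 (mod 8)`: this file; `p ≡ 7 (mod 8)`: p645829). Nothing is claimed about the analytic rank
of `E_{2p}` itself. [cite: HeathBrown1994SelmerCongruentII, Appendix (Monsky), typescript p. 41 L20–L36] [cite: BurungaleTian2026, Thm. 1.1]
[cite: BurungaleFlach2024, Thm. 1.1 and Cor. 2] [cite: KoblitzECMF1993, Ch. II §5, Theorem (p. 84)] -/
theorem cruxOnE2pCorner_of_facts (hmod : ModularForms.exists_isNewformOf) (hM : monsky_card_selmerGroup_two_even)
    (hBT : burungaleTian_analyticRank_eq_zero_of_selmerCorank_eq_zero_of_hasCM)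
    (hH : hasEntireLFunction_of_j_mem_maximalCMJInvariants) (hBF : bsdTriple_of_hasCM_of_L_one_ne_zero) :
    ∀ (p : ℕ) [Fact p.Prime] [(congruentNumberCurve (2 * p)).IsElliptic]
      [(congruentNumberCurve (2 * p)).IsGloballyMinimal]
      [NeZero ((congruentNumberCurve (2 * p)).conductorNorm ℤ)],
      p % 4 = 3 → 7 ≤ p →
      ∃ (K : Type) (_ : Field K) (_ : NumberField K),
        IsImaginaryQuadratic K ∧ 4 < (NumberField.discr K).natAbs ∧
        SatisfiesHeegnerHypothesis ((congruentNumberCurve (2 * p)).conductorNorm ℤ) K ∧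
        ((congruentNumberCurve (2 * p)).quadraticTwist (NumberField.discr K : ℚ)).entireLFunction 1 ≠ 0 ∧
        NumberField.classNumber K < p ∧ ¬ p ∣ NumberField.classNumber K := by
  intro p hpF _ _ _ hp4 h7
  have hp : p.Prime := hpF.out
  have hfin : ∀ (K : Type) [Field K] [NumberField K], NumberField.classNumber K < p →
      ¬ p ∣ NumberField.classNumber K := fun K _ _ hlt hdvd =>
    absurd (Nat.le_of_dvd (NumberField.classNumber_pos K) hdvd) (not_le.mpr hlt)
  have hp5 : (p % 5 = 2 ∨ p % 5 = 3) ∨ (p % 5 = 1 ∨ p % 5 = 4) := by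
    have : p % 5 ≠ 0 := fun h0 => by
      have : 5 ∣ p := Nat.dvd_of_mod_eq_zero h0
      rcases (Nat.prime_dvd_prime_iff_eq Nat.prime_five hp).mp this with h
      omega
    omega
  rcases hp5 with hA | hB
  · obtain ⟨q, K, iF, iN, hq, -, -, hK, hdK, hHg, hL, hcl⟩ :=
      cruxOnE2pCornerCellA_of_facts hmod hM hBT hH hBF p hp4 hA h7
    refine ⟨K, iF, iN, hK, ?_, hHg, hL, hcl, hfin K hcl⟩
    rw [hdK, Int.natAbs_neg, Int.natAbs_natCast]
    have := hq.two_le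
    omega
  · rcases (show p % 8 = 3 ∨ p % 8 = 7 by omega) with h3 | h7'
    · obtain ⟨q, K, iF, iN, hq, -, -, hK, hdK, hHg, hL, hcl⟩ :=
        cruxOnE2pCornerCellB_of_mod_eight_eq_three_of_facts hmod hM hBT hH hBF p h3 hB
      refine ⟨K, iF, iN, hK, ?_, hHg, hL, hcl, hfin K hcl⟩
      rw [hdK, Int.natAbs_neg, Int.natAbs_natCast]
      have := hq.two_le
      omega
    · have h11 : 11 < p := by omega
      obtain ⟨q, K, iF, iN, hq, -, -, -, hK, hdK, hHg, hL, hcl⟩ :=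
        cruxOnE2pCornerMod5_of_mod_eight_eq_seven_of_facts hmod hM hBT hH hBF p h7' hp4 hB h11
      refine ⟨K, iF, iN, hK, ?_, hHg, hL, hcl, hfin K hcl⟩
      rw [hdK, Int.natAbs_neg, Int.natAbs_natCast]
      have := hq.two_le
      omega

/-- **Corner `W = E_p`, row-1 cell with the partner `5`: every prime `p ≡ 7 (mod 8)`, `p ≡ ±2 (mod 5)`** — modulo
Modularity + Monsky (odd) + Burungale–Tian + Deuring–Hecke + Burungale–Flach: an auxiliary prime `q ≡ 3 (mod 8)` with
`(q/p) = +1` (needed for the Heegner hypothesis at `p`, not for the determinant) and `K′ = ℚ(√−5q)` of `N(E_p) = 32p²`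
with `L(E_p^{(−5q)}, 1) ≠ 0` and `h(K′) < p`. [cite: HeathBrown1994SelmerCongruentII, Appendix (Monsky), typescript p. 39 L27–L33]
[cite: BurungaleTian2026, Thm. 1.1] [cite: BurungaleFlach2024, Thm. 1.1 and Cor. 2] [cite: KoblitzECMF1993, Ch. II §5, Theorem (p. 84)] -/
theorem cruxOnEpCornerCellA_of_facts (hmod : ModularForms.exists_isNewformOf) (hM : monsky_card_selmerGroup_two_odd)
    (hBT : burungaleTian_analyticRank_eq_zero_of_selmerCorank_eq_zero_of_hasCM)
    (hH : hasEntireLFunction_of_j_mem_maximalCMJInvariants) (hBF : bsdTriple_of_hasCM_of_L_one_ne_zero) :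
    ∀ (p : ℕ) [Fact p.Prime] [(congruentNumberCurve p).IsElliptic]
      [(congruentNumberCurve p).IsGloballyMinimal] [NeZero ((congruentNumberCurve p).conductorNorm ℤ)],
      p % 8 = 7 → (p % 5 = 2 ∨ p % 5 = 3) →
      ∃ (q : ℕ) (K : Type) (_ : Field K) (_ : NumberField K),
        q.Prime ∧ q % 8 = 3 ∧ jacobiSym (q : ℤ) p = 1 ∧
        IsImaginaryQuadratic K ∧ NumberField.discr K = -((5 * q : ℕ) : ℤ) ∧
        SatisfiesHeegnerHypothesis ((congruentNumberCurve p).conductorNorm ℤ) K ∧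
        ((congruentNumberCurve p).quadraticTwist (NumberField.discr K : ℚ)).entireLFunction 1 ≠ 0 ∧
        NumberField.classNumber K < p := by
  intro p hpF _ _ _ hp8 hp5
  have hp : p.Prime := hpF.out
  have hp4 : p % 4 = 3 := by omega
  obtain ⟨q, hq, hq8, hJ, hh⟩ := exists_threePlus_classNumber_lt hp hp4 hp5 (by omega)
  have hqp : q ≠ p := ne_of_jacobiSym_ne_zero hp (by rw [hJ]; norm_num)
  obtain ⟨-, -, -, hL⟩ := analyticRank_eq_zero_odd_five hM hBT hH hBF hp hp8 hp5 hq hq8 hqp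
  have hN : (congruentNumberCurve p).conductorNorm ℤ = 32 * p ^ 2 :=
    conductorNorm_congruentNumberCurve_of_odd hmod hp.squarefree (Nat.odd_iff.mpr (by omega))
  obtain ⟨K, iF, iN, hK, hdK, hH', hcl⟩ := exists_witnessField_five_of (N := (congruentNumberCurve p).conductorNorm ℤ)
    hq hq8 (jacobiSym_neg_five_mul_cellA hp4 hp5 hJ) hh
    (fun r hr hrN => eq_two_or_eq_of_prime_dvd_thirtyTwo_mul_sq hp hr (hN ▸ hrN))
  refine ⟨q, K, iF, iN, hq, hq8, hJ, hK, hdK, hH', ?_, hcl⟩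
  rw [hdK, quadraticTwist_congruentNumberCurve, Int.natAbs_neg, Int.natAbs_natCast]
  have h55 : p * (5 * q) = p * (q * 5) := by ring
  rw [h55]
  exact hL

/-- **Corner `W = E_p`: every prime `p ≡ 7 (mod 8)` with `p ≡ 2 (mod 3)` or `p ≡ ±2 (mod 5)`** — modulo the five
named facts, a Heegner field `K′` of `N(E_p)` with `4 < |d_{K′}|`, `L(E_p^{(d_{K′})}, 1) ≠ 0`, `h(K′) < p`, `p ∤ h(K′)`
(p645024's `p ≡ 23 (mod 24)` corner with `K′ = ℚ(√−3ℓ)`, else this file's cell with `K′ = ℚ(√−5q)`). Left open on the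
`E_p` family: `p ≡ 7 (mod 8)`, `p ≡ 1 (mod 3)`, `p ≡ ±1 (mod 5)`. [cite: HeathBrown1994SelmerCongruentII, Appendix (Monsky), typescript p. 39 L27–L33]
[cite: BurungaleTian2026, Thm. 1.1] [cite: BurungaleFlach2024, Thm. 1.1 and Cor. 2] [cite: KoblitzECMF1993, Ch. II §5, Theorem (p. 84)] -/
theorem cruxOnEpCorner_of_facts (hmod : ModularForms.exists_isNewformOf) (hM : monsky_card_selmerGroup_two_odd)
    (hBT : burungaleTian_analyticRank_eq_zero_of_selmerCorank_eq_zero_of_hasCM)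
    (hH : hasEntireLFunction_of_j_mem_maximalCMJInvariants) (hBF : bsdTriple_of_hasCM_of_L_one_ne_zero) :
    ∀ (p : ℕ) [Fact p.Prime] [(congruentNumberCurve p).IsElliptic]
      [(congruentNumberCurve p).IsGloballyMinimal] [NeZero ((congruentNumberCurve p).conductorNorm ℤ)],
      p % 8 = 7 → (p % 3 = 2 ∨ p % 5 = 2 ∨ p % 5 = 3) →
      ∃ (K : Type) (_ : Field K) (_ : NumberField K),
        IsImaginaryQuadratic K ∧ 4 < (NumberField.discr K).natAbs ∧
        SatisfiesHeegnerHypothesis ((congruentNumberCurve p).conductorNorm ℤ) K ∧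
        ((congruentNumberCurve p).quadraticTwist (NumberField.discr K : ℚ)).entireLFunction 1 ≠ 0 ∧
        NumberField.classNumber K < p ∧ ¬ p ∣ NumberField.classNumber K := by
  intro p hpF _ _ _ hp8 hcase
  have hp : p.Prime := hpF.out
  have hfin : ∀ (K : Type) [Field K] [NumberField K], NumberField.classNumber K < p →
      ¬ p ∣ NumberField.classNumber K := fun K _ _ hlt hdvd =>
    absurd (Nat.le_of_dvd (NumberField.classNumber_pos K) hdvd) (not_le.mpr hlt)
  by_cases h5 : p % 5 = 2 ∨ p % 5 = 3
  · obtain ⟨q, K, iF, iN, hq, -, -, hK, hdK, hHg, hL, hcl⟩ := cruxOnEpCornerCellA_of_facts hmod hM hBT hH hBF p hp8 h5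
    refine ⟨K, iF, iN, hK, ?_, hHg, hL, hcl, hfin K hcl⟩
    rw [hdK, Int.natAbs_neg, Int.natAbs_natCast]
    have := hq.two_le
    omega
  · have h3 : p % 3 = 2 := by tauto
    have hp24 : p % 24 = 23 := by omega
    obtain ⟨ℓ, K, iF, iN, hℓ, -, -, -, hK, hdK, hHg, hL, hcl⟩ := cruxOnEpCornerMod24_of_facts hmod hM hBT hH hBF p hp24
    refine ⟨K, iF, iN, hK, ?_, hHg, hL, hcl, hfin K hcl⟩
    rw [hdK, Int.natAbs_neg, Int.natAbs_natCast]
    have := hℓ.two_le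
    omega

end Summit.BirchSwinnertonDyer.BirchSwinnertonDyer.Theorems.BiquadraticEisensteinDescentHeegnerTwistCouplingInSupplyIndefinitePinCorner
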